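/-
Copyright: statement-level skeleton of a published paper (lit-balaban cell, reader/typer r15). No proof claims beyond
what the kernel checks below.
-/
import Literature.MathematicalPhysics.QuantumFieldTheory.Balaban1983to89.B3Sect3ScalarSelfEnergy

/-!
# B3 — T. Bałaban, *(Higgs)₂,₃ quantum fields in a finite volume. III. Renormalization*, CMP **88** (1983) 411–445
[Balaban1983Higgs3], Sect. 1 p. 419: the worked example (1.31) of the definition (1.29)

statement-level skeleton of published theorems with citation tags; proofs where landed; nothing here is a claim about
the Yang–Mills mass gap

CITATION HEADER.  T. Bałaban, *(Higgs)₂,₃ quantum fields in a finite volume. III. Renormalization*, Commun. Math.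
Phys. **88** (1983) 411–445, doi:10.1007/BF01213217 [Balaban1983Higgs3]; the running coupling
*"e(L^kε) = e(L^kε)^{(4−d)/2}, η = L^{−k}"* and the rescaled propagator *"G_k(Ω, A) = (−Δ^η_A + m²(L^kε)² +
a_kP_k(A))^{−1} (2.22)"* are [Balaban1982Higgs1] p. 610 (T. Bałaban, *(Higgs)₂,₃ quantum fields in a finite volume.
I. A lower bound*, Commun. Math. Phys. **85** (1982) 603–626).  Source: held text
`paper:balaban1983-higgs-2-3-quantum-fields-finite-volume` (journal page = PDF page + 410); the display (1.31) was read
on the page render `run/shared/lean/pub/pub-balaban/b2b-balaban-ref1/pages/1983-cmp88-higgs23-III/1983-cmp88-higgs23-III-p009-x4.png`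
(strip crops ×2/×4; the OCR of this display is unusable).  Row **B3.Eq1.31** of `HOME/lit-balaban-r15/ROWS-B3.md`
(reader/typer r15, fold owner of B3; the row stood «absent (illustration of B3.Eq1.29-1.30)» through ROWS-B3 v1.26).
REUSED, nothing re-declared: the torus calculus `LatticeFieldCalculus` (`Site P j`, `SiteField`, `pdiff`/`pdiffAdj`)
and r15's kernel vocabulary of `B3Sect3ScalarSelfEnergy` (`Kernel P j` = `Site P j → Site P j → ℝ`, `kernelOp`, and
`dKernel c μ G` = the kernel of ∂_μ∘G∘∂^*_μ, PROVED there as `kernelOp_dKernel`); the abstract bookkeeping companions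
are r15's `B3Sect1Statements.eq125` ((1.25)), `eq127` ((1.27)), `eq128` ((1.28)).

THE PRINTED TEXT (verbatim, p. 419 [PDF 9]).  *"the dependence on e′, λ′ is obtained by replacing e, λ by e′e, λ′λ.
Let us illustrate the definition (1.29) for one of the basic counterterms in (1.23):
−e² Σ_{x′∈T_ε} ε^d Σ_{μ=1}^d q(∂^ε_μC^ε_0∂^{ε*}_μ)(x−x′)qC^ε(x−x′)(L^kε)², x ∈ T_ε,
is replaced by
[−e²a_k(L^Kε)^{−2} Σ_{x′∈T_ε} ε^d Σ_{μ=1}^d q(∂^ε_μG^ε_K(0)P_KC^ε_0∂^{ε*}_μ)(x,x′)qC^ε(x−x′)(L^kε)²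
 −e²a_k(L^Kε)^{−2} Σ_{x′∈T_ε} ε^d Σ_{μ=1}^d q(∂^ε_μG^ε_K(0)∂^{ε*}_μ)(x,x′)q(G^ε_KP_KC^ε)(x,x′)(L^kε)²]
+ [−e² Σ_{x′∈T_ε} ε^d Σ_{μ=1}^d q(∂^ε_μG^ε_{K,k}(0)∂^{ε*}_μ)(x,x′)qG^ε_K(x,x′)(L^kε)²
 −e² Σ_{x′∈T_ε} ε^d Σ_{μ=1}^d q(∂^ε_μG^ε_k(0)∂^{ε*}_μ)(x,x′)qG^ε_{K,k}(x,x′)(L^kε)²]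
+ [−(e(L^kε))² Σ_{x′∈T_η} η^d Σ_{μ=1}^d g_k((L^kε)^{−1}x)q(∂^η_μG_k(0)∂^{η*}_μ)((L^kε)^{−1}x,x′)
 ·qg_k(x′)G_k((L^kε)^{−1}x,x′)]. (1.31)
Thus we have finished the description of the perturbative expressions"*.

WHAT IS TYPED / PROVED.
* `basicCT w c e q2 s2 A B x` — the displayed basic counterterm −e²Σ_{x′}wΣ_μ q(∂_μA∂^*_μ)(x,x′)qB(x,x′)·s2 as a
  def with body on the torus `Site P j` (volume element `w` = ε^d, difference quotient `c` = ε^{−1}, `s2` = (L^kε)²,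
  `A` = the propagator carrying the two derivatives (C^ε_0 and its pieces), `B` = the other line); it is BILINEAR in
  (A, B) (`basicCT_add_left/right`, `basicCT_smul_left/right`, packaged `basicCTBil`).
* **The substitution behind (1.31) PROVED** (`split131` for any bilinear expression, `eq131` for `basicCT`): inserting
  (1.25) C^ε_0 = G^ε_K(0) + a(L^Kε)^{−2}·G^ε_K(0)P_KC^ε_0, C^ε = G^ε_K + a(L^Kε)^{−2}·G^ε_KP_KC^ε and (1.27)
  G^ε_K(0) = G^ε_k(0) + G^ε_{K,k}(0), G^ε_K = G^ε_k + G^ε_{K,k} splits the counterterm EXACTLY into the first square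
  bracket of (1.31) (the δm²_fin-terms), the second square bracket (the δm²_{K,k}-terms) and the all-G^ε_k term
  −e²Σ ε^dΣ_μ q(∂^ε_μG^ε_k(0)∂^{ε*}_μ)(x,x′)qG^ε_k(x,x′)(L^kε)².
* **The rescaling to the η-lattice PROVED** (`dKernel_rescale`, `basicCT_rescale`, `basicCT_rescale_balaban`): with
  ε = s·η (s = L^kε; same site set `Site P j` read with the two spacings), ε^d = s^dη^d, ε^{−1} = η^{−1}/s and the
  kernels of G^ε_k(0), G^ε_k equal to s²/s^d times those of the rescaled η-lattice operators G_k(0), G_k (T4), the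
  all-G^ε_k term with coupling e and the factor (L^kε)² equals the η-lattice term with coupling e_k, e_k² = e²s⁴/s^d
  = (e(L^kε))² (`ek_sq_two`, `ek_sq_three`: the printed e(L^kε) = e(L^kε)^{(4−d)/2} for d = 2, 3).
* The last square bracket AS PRINTED, with the localization g_k at both vertices, is the def with body `basicCTLoc`;
  for g_k ≡ 1 it is the un-localized η-lattice term (`basicCTLoc_one`).  The whole right side of (1.31) is
  `replaced131` (def with body), and **`replaced131_eq`**: for g_k ≡ 1 the replacement (1.31) is an identity —
  original counterterm = right side of (1.31) — under (1.25)/(1.27) and the rescaling relations; for a general g_k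
  (1.31) is the DEFINITION (1.29) of the localized counterterm and nothing more is claimed.
TRANSCRIPT NOTES.  T1: the two charge matrices q…q of the display are carried as ONE real factor `q2` (the
propagators at zero field are multiples of the identity in the internal indices; precedent: `B3Sect3TriangleGraphs.lhs337`
carries q³ as `q3 : ℝ`).  T2: the print has `a_k(L^Kε)^{−2}` (lower-case k) in the first bracket where (1.25) p. 418
has `a_K(L^Kε)^{−2}`; typed with a supplied coefficient `aK2` standing for a_K(L^Kε)^{−2} — recorded, not adjudicated.
T3: kernel convention as in `B3Sect3ScalarSelfEnergy` ((3.9)): (Kf)(x) = Σ_{x′}w·K(x,x′)f(x′), so the kernel of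
∂_μA∂^*_μ is the forward difference quotient of A in both arguments (`dKernel`); the translation-invariant kernels
"(…)(x−x′)" of the display are the special case K(x,x′) = k(x−x′) and are not singled out.  T4: the factor s²/s^d
between ε- and η-kernels is the operator factor (L^kε)² of [Balaban1982Higgs1] (2.22) (G^ε_k = (L^kε)²·G_k after
x = (L^kε)y) times the change s^{−d} of the volume element in the kernel convention T3; it enters `basicCT_rescale`
as a HYPOTHESIS on the supplied kernels (σA = σB = s²/s^d in `basicCT_rescale_balaban`), nothing about the concrete
propagators is asserted here.  NOTHING beyond the kernel-checked statements below is asserted; in particular the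
claim δm²_{K,k}(x) = O((L^kε)^{−1}) of (1.28) is not touched.
-/

open scoped BigOperators

namespace Literature.MathematicalPhysics.QuantumFieldTheory.Balaban1983to89.B3Eq131Example

open LatticeFieldCalculus B3Sect3ScalarSelfEnergy

variable {P : Params} {j : ℕ}

/-! ## The basic counterterm of (1.23)/(1.31) and its bilinearity -/

/-- **(1.31), first display** p. 419 [PDF 9], verbatim: *"−e² Σ_{x′∈T_ε} ε^d Σ_{μ=1}^d q(∂^ε_μC^ε_0∂^{ε*}_μ)(x−x′)
qC^ε(x−x′)(L^kε)², x ∈ T_ε"* — as a function of the two propagators: `basicCT w c e q2 s2 A B x =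
−e²·Σ_{x′} w·Σ_μ q2·(∂_μA∂^*_μ)(x,x′)·B(x,x′)·s2` with `w` = ε^d, `c` = ε^{−1} (inside `dKernel`), `s2` = (L^kε)², the
charge matrices as the real factor `q2` (T1), `A` = C^ε_0 (and its pieces), `B` = C^ε (and its pieces).
[cite: Balaban1983Higgs3, (1.31) p.419] -/
def basicCT (w c e q2 s2 : ℝ) (A B : Kernel P j) (x : Site P j) : ℝ :=
  -(e ^ 2) * ∑ x' : Site P j, w * ∑ μ : Fin P.d, q2 * dKernel c μ A x x' * B x x' * s2

/-- the kernel (∂_μA∂^*_μ)(x,x′) is additive in A. [cite: Balaban1983Higgs3, (1.31) p.419] -/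
theorem dKernel_add (c : ℝ) (μ : Fin P.d) (A B : Kernel P j) :
    dKernel c μ (A + B) = dKernel c μ A + dKernel c μ B := by
  funext x x'
  simp only [dKernel, Pi.add_apply]
  ring

/-- the kernel (∂_μA∂^*_μ)(x,x′) is homogeneous in A. [cite: Balaban1983Higgs3, (1.31) p.419] -/
theorem dKernel_smul (c a : ℝ) (μ : Fin P.d) (A : Kernel P j) :
    dKernel c μ (a • A) = a • dKernel c μ A := by
  funext x x'
  simp only [dKernel, Pi.smul_apply, smul_eq_mul]
  ring

/-- `basicCT` is additive in the derivative-carrying propagator `A`. [cite: Balaban1983Higgs3, (1.31) p.419] -/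
theorem basicCT_add_left (w c e q2 s2 : ℝ) (A A' B : Kernel P j) (x : Site P j) :
    basicCT w c e q2 s2 (A + A') B x = basicCT w c e q2 s2 A B x + basicCT w c e q2 s2 A' B x := by
  simp only [basicCT, dKernel_add, Pi.add_apply, ← mul_add, ← Finset.sum_add_distrib]
  congr 1
  refine Finset.sum_congr rfl fun x' _ => ?_
  congr 1
  exact Finset.sum_congr rfl fun μ _ => by ring

/-- `basicCT` is additive in the second propagator `B`. [cite: Balaban1983Higgs3, (1.31) p.419] -/
theorem basicCT_add_right (w c e q2 s2 : ℝ) (A B B' : Kernel P j) (x : Site P j) :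
    basicCT w c e q2 s2 A (B + B') x = basicCT w c e q2 s2 A B x + basicCT w c e q2 s2 A B' x := by
  simp only [basicCT, Pi.add_apply, ← mul_add, ← Finset.sum_add_distrib]
  congr 1
  refine Finset.sum_congr rfl fun x' _ => ?_
  congr 1
  exact Finset.sum_congr rfl fun μ _ => by ring

/-- `basicCT` is homogeneous in `A`. [cite: Balaban1983Higgs3, (1.31) p.419] -/
theorem basicCT_smul_left (w c e q2 s2 a : ℝ) (A B : Kernel P j) (x : Site P j) :
    basicCT w c e q2 s2 (a • A) B x = a * basicCT w c e q2 s2 A B x := by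
  simp only [basicCT, dKernel_smul, Pi.smul_apply, smul_eq_mul, Finset.mul_sum]
  exact Finset.sum_congr rfl fun x' _ => Finset.sum_congr rfl fun μ _ => by ring

/-- `basicCT` is homogeneous in `B`. [cite: Balaban1983Higgs3, (1.31) p.419] -/
theorem basicCT_smul_right (w c e q2 s2 a : ℝ) (A B : Kernel P j) (x : Site P j) :
    basicCT w c e q2 s2 A (a • B) x = a * basicCT w c e q2 s2 A B x := by
  simp only [basicCT, Pi.smul_apply, smul_eq_mul, Finset.mul_sum]
  exact Finset.sum_congr rfl fun x' _ => Finset.sum_congr rfl fun μ _ => by ring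

/-- The basic counterterm at the point `x` as a BILINEAR map of the two propagators.
[cite: Balaban1983Higgs3, (1.31) p.419] -/
def basicCTBil (w c e q2 s2 : ℝ) (x : Site P j) : Kernel P j →ₗ[ℝ] Kernel P j →ₗ[ℝ] ℝ :=
  LinearMap.mk₂ ℝ (fun A B => basicCT w c e q2 s2 A B x)
    (fun A A' B => basicCT_add_left w c e q2 s2 A A' B x)
    (fun a A B => by rw [smul_eq_mul]; exact basicCT_smul_left w c e q2 s2 a A B x)
    (fun A B B' => basicCT_add_right w c e q2 s2 A B B' x)
    (fun a A B => by rw [smul_eq_mul]; exact basicCT_smul_right w c e q2 s2 a A B x)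

/-- `basicCTBil` evaluates to `basicCT` (definitional). [cite: Balaban1983Higgs3, (1.31) p.419] -/
@[simp] theorem basicCTBil_apply (w c e q2 s2 : ℝ) (x : Site P j) (A B : Kernel P j) :
    basicCTBil w c e q2 s2 x A B = basicCT w c e q2 s2 A B x := rfl

/-! ## (1.31): the substitution of (1.25) and (1.27) -/

/-- **The bookkeeping of (1.31), abstractly** — for ANY expression `E` bilinear in (derivative-carrying propagator,
second propagator): substituting (1.25) `C0 = GK0 + a • R0`, `C = GK + a • R1` (R0 = G^ε_K(0)P_KC^ε_0,
R1 = G^ε_KP_KC^ε, a = a_K(L^Kε)^{−2}) and (1.27) `GK0 = Gk0 + GKk0`, `GK = Gk + GKk` gives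
E(C0,C) = [a·E(R0,C) + a·E(GK0,R1)] + [E(GKk0,GK) + E(Gk0,GKk)] + E(Gk0,Gk) — the two square brackets and the
all-G^ε_k term of (1.31), in the printed order.  PROVED. [cite: Balaban1983Higgs3, (1.31) p.419] -/
theorem split131 {R M N T : Type*} [CommSemiring R] [AddCommMonoid M] [AddCommMonoid N] [AddCommMonoid T]
    [Module R M] [Module R N] [Module R T] (E : M →ₗ[R] N →ₗ[R] T)
    {C0 GK0 Gk0 GKk0 R0 : M} {C GK Gk GKk R1 : N} {a : R}
    (h0 : C0 = GK0 + a • R0) (h1 : C = GK + a • R1) (h0' : GK0 = Gk0 + GKk0) (h1' : GK = Gk + GKk) :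
    E C0 C = (a • E R0 C + a • E GK0 R1) + (E GKk0 GK + E Gk0 GKk) + E Gk0 Gk := by
  have e1 : E C0 C = E GK0 C + a • E R0 C := by
    rw [h0, map_add, map_smul, LinearMap.add_apply, LinearMap.smul_apply]
  have e2 : E GK0 C = E GK0 GK + a • E GK0 R1 := by rw [h1, map_add, map_smul]
  have e3 : E GK0 GK = E Gk0 GK + E GKk0 GK := by rw [h0', map_add, LinearMap.add_apply]
  have e4 : E Gk0 GK = E Gk0 Gk + E Gk0 GKk := by rw [h1', map_add]
  rw [e1, e2, e3, e4]
  abel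

/-- **(1.31), the substitution step, PROVED for the displayed counterterm**: with (1.25) `C0 = GK0 + aK2 • R0`,
`C = GK + aK2 • R1` and (1.27) `GK0 = Gk0 + GKk0`, `GK = Gk + GKk` (kernels on T_ε),
`−e²Σε^dΣ_μ q(∂C^ε_0∂^*)qC^ε(L^kε)²` = [aK2·(…R0…C…) + aK2·(…GK0…R1…)] + [(…GKk0…GK…) + (…Gk0…GKk…)] + (…Gk0…Gk…),
i.e. the first two square brackets of (1.31) verbatim (T2: `aK2` = the printed prefactor a_k(L^Kε)^{−2}) plus the
all-G^ε_k term, still on the ε-lattice. [cite: Balaban1983Higgs3, (1.31) p.419] -/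
theorem eq131 (w c e q2 s2 aK2 : ℝ) {C0 GK0 Gk0 GKk0 R0 C GK Gk GKk R1 : Kernel P j}
    (h125₀ : C0 = GK0 + aK2 • R0) (h125 : C = GK + aK2 • R1) (h127₀ : GK0 = Gk0 + GKk0) (h127 : GK = Gk + GKk)
    (x : Site P j) :
    basicCT w c e q2 s2 C0 C x =
      (aK2 * basicCT w c e q2 s2 R0 C x + aK2 * basicCT w c e q2 s2 GK0 R1 x)
      + (basicCT w c e q2 s2 GKk0 GK x + basicCT w c e q2 s2 Gk0 GKk x)
      + basicCT w c e q2 s2 Gk0 Gk x := by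
  have h := split131 (basicCTBil w c e q2 s2 x) h125₀ h125 h127₀ h127
  simpa only [basicCTBil_apply, smul_eq_mul] using h

/-! ## (1.31), last bracket: rescaling to the η-lattice and localization -/

/-- **(1.31), last square bracket** p. 419, verbatim: *"−(e(L^kε))² Σ_{x′∈T_η} η^d Σ_{μ=1}^d g_k((L^kε)^{−1}x)
q(∂^η_μG_k(0)∂^{η*}_μ)((L^kε)^{−1}x,x′)·qg_k(x′)G_k((L^kε)^{−1}x,x′)"* — the δm²_k-term of (1.29) on the η-lattice
(same site set, volume element `w` = η^d, difference quotient `c` = η^{−1}), coupling `ek` = e(L^kε), with the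
localization function `g` = g_k at both vertices (p. 419: *"The other vertices are localized by functions g_k multiplying
each leg of the vector field (or each coupling constant e)"*); `y` = (L^kε)^{−1}x. Def with body.
[cite: Balaban1983Higgs3, (1.31) p.419] -/
def basicCTLoc (w c ek q2 : ℝ) (g : SiteField P j ℝ) (A B : Kernel P j) (y : Site P j) : ℝ :=
  -(ek ^ 2) * ∑ y' : Site P j, w * ∑ μ : Fin P.d, g y * (q2 * dKernel c μ A y y') * (g y' * B y y')

/-- Without localization (g_k ≡ 1) the last bracket is the un-localized η-lattice counterterm (no factor (L^kε)²:
`s2 = 1`, as printed). [cite: Balaban1983Higgs3, (1.31) p.419] -/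
theorem basicCTLoc_one (w c ek q2 : ℝ) (A B : Kernel P j) (y : Site P j) :
    basicCTLoc w c ek q2 (fun _ => (1 : ℝ)) A B y = basicCT w c ek q2 1 A B y := by
  simp only [basicCTLoc, basicCT, one_mul, mul_one]

/-- Rescaling of the kernel (∂_μA∂^*_μ)(x,x′): with the difference quotient `c/s` (ε^{−1} = η^{−1}/s, ε = sη) and a
kernel `σ • A`, `dKernel (c/s) μ (σ • A) = (σ/s²) • dKernel c μ A`. [cite: Balaban1983Higgs3, (1.31) p.419] -/
theorem dKernel_rescale (c s σ : ℝ) (hs : s ≠ 0) (μ : Fin P.d) (A : Kernel P j) :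
    dKernel (c / s) μ (σ • A) = (σ / s ^ 2) • dKernel c μ A := by
  funext x x'
  simp only [dKernel, Pi.smul_apply, smul_eq_mul]
  field_simp

/-- **Rescaling ε-lattice → η-lattice, PROVED** (generic exponents): if ε^d = s^d·η^d (`w`), ε^{−1} = η^{−1}/s (`c`)
and the ε-kernels are `σA • Aη`, `σB • Bη`, then the ε-lattice counterterm with coupling `e` and factor `s2` equals the
η-lattice counterterm with coupling `ek` and factor 1 as soon as `ek² = e²·(s^d·σA·σB·s2/s²)`.
[cite: Balaban1983Higgs3, (1.31) p.419] -/
theorem basicCT_rescale (wη cη e ek q2 s2 s σA σB : ℝ) (hs : s ≠ 0) (Aη Bη : Kernel P j)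
    (hek : ek ^ 2 = e ^ 2 * (s ^ P.d * σA * σB * s2 / s ^ 2)) (x : Site P j) :
    basicCT (s ^ P.d * wη) (cη / s) e q2 s2 (σA • Aη) (σB • Bη) x = basicCT wη cη ek q2 1 Aη Bη x := by
  unfold basicCT
  rw [hek]
  simp only [dKernel_rescale _ _ _ hs, Pi.smul_apply, smul_eq_mul, Finset.mul_sum]
  refine Finset.sum_congr rfl fun x' _ => Finset.sum_congr rfl fun μ _ => ?_
  field_simp

/-- d = 2: the printed running coupling e(L^kε) = e(L^kε)^{(4−d)/2} = e·s satisfies `ek² = e²·s⁴/s^d`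
([Balaban1982Higgs1] p. 610). [cite: Balaban1982Higgs1, (2.23) p.610] -/
theorem ek_sq_two (e s : ℝ) (hs : s ≠ 0) : (e * s) ^ 2 = e ^ 2 * (s ^ 4 / s ^ 2) := by
  field_simp

/-- d = 3: the printed running coupling e(L^kε) = e(L^kε)^{(4−d)/2} = e·√s satisfies `ek² = e²·s⁴/s^d` for s > 0
([Balaban1982Higgs1] p. 610). [cite: Balaban1982Higgs1, (2.23) p.610] -/
theorem ek_sq_three (e s : ℝ) (hs : 0 < s) : (e * Real.sqrt s) ^ 2 = e ^ 2 * (s ^ 4 / s ^ 3) := by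
  rw [mul_pow, Real.sq_sqrt hs.le]
  field_simp

/-- **The last bracket of (1.31) from the all-G^ε_k term, PROVED** (Bałaban's exponents, T4): with ε^d = s^dη^d,
ε^{−1} = η^{−1}/s, (L^kε)² = s², and the kernels of G^ε_k(0), G^ε_k equal to s²/s^d times those of the η-lattice
operators G_k(0), G_k, the ε-lattice term with coupling e is the η-lattice term with coupling e_k, e_k² = e²s⁴/s^d =
(e(L^kε))² (`ek_sq_two`, `ek_sq_three`). [cite: Balaban1983Higgs3, (1.31) p.419] -/
theorem basicCT_rescale_balaban (wη cη e ek q2 s : ℝ) (hs : s ≠ 0) (Aη Bη : Kernel P j)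
    (hek : ek ^ 2 = e ^ 2 * (s ^ 4 / s ^ P.d)) (x : Site P j) :
    basicCT (s ^ P.d * wη) (cη / s) e q2 (s ^ 2) ((s ^ 2 / s ^ P.d) • Aη) ((s ^ 2 / s ^ P.d) • Bη) x
      = basicCT wη cη ek q2 1 Aη Bη x :=
  basicCT_rescale wη cη e ek q2 (s ^ 2) s _ _ hs Aη Bη
    (by rw [hek]; field_simp) x

/-! ## (1.31) assembled -/

/-- **The right side of (1.31)** (def with body): the two square brackets on the ε-lattice (volume element `wε`,
difference quotient `cε`, coupling `e`, factor `s2` = (L^kε)², prefactor `aK2` = a_K(L^Kε)^{−2} (T2); kernels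
R0 = G^ε_K(0)P_KC^ε_0, C = C^ε, GK0 = G^ε_K(0), R1 = G^ε_KP_KC^ε, GKk0 = G^ε_{K,k}(0), GK = G^ε_K, Gk0 = G^ε_k(0),
GKk = G^ε_{K,k}) plus the last bracket on the η-lattice (`wη`, `cη`, coupling `ek` = e(L^kε), localization `g`,
kernels `Hk0` = G_k(0), `Hk` = G_k), all read at the same site `x` (= (L^kε)^{−1}x on T_η).
[cite: Balaban1983Higgs3, (1.31) p.419] -/
def replaced131 (wε cε e q2 s2 aK2 wη cη ek : ℝ) (R0 C GK0 R1 GKk0 GK Gk0 GKk : Kernel P j)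
    (g : SiteField P j ℝ) (Hk0 Hk : Kernel P j) (x : Site P j) : ℝ :=
  (aK2 * basicCT wε cε e q2 s2 R0 C x + aK2 * basicCT wε cε e q2 s2 GK0 R1 x)
  + (basicCT wε cε e q2 s2 GKk0 GK x + basicCT wε cε e q2 s2 Gk0 GKk x)
  + basicCTLoc wη cη ek q2 g Hk0 Hk x

/-- **(1.31) as an identity when no localization is imposed (g_k ≡ 1), PROVED**: under (1.25)/(1.27) for the
ε-lattice kernels and the rescaling relations of `basicCT_rescale_balaban` (ε^d = s^dη^d, ε^{−1} = η^{−1}/s,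
(L^kε)² = s², G^ε_k(0) = (s²/s^d)•G_k(0), G^ε_k = (s²/s^d)•G_k as kernels, e_k² = e²s⁴/s^d), the displayed
counterterm EQUALS the right side of (1.31).  For a general g_k the right side is the definition (1.29) of the
localized counterterm and no identity is claimed. [cite: Balaban1983Higgs3, (1.31) p.419] -/
theorem replaced131_eq (wη cη e ek q2 s aK2 : ℝ) (hs : s ≠ 0)
    {C0 GK0 Gk0 GKk0 R0 C GK Gk GKk R1 Hk0 Hk : Kernel P j}
    (h125₀ : C0 = GK0 + aK2 • R0) (h125 : C = GK + aK2 • R1) (h127₀ : GK0 = Gk0 + GKk0) (h127 : GK = Gk + GKk)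
    (hGk0 : Gk0 = (s ^ 2 / s ^ P.d) • Hk0) (hGk : Gk = (s ^ 2 / s ^ P.d) • Hk)
    (hek : ek ^ 2 = e ^ 2 * (s ^ 4 / s ^ P.d)) (x : Site P j) :
    basicCT (s ^ P.d * wη) (cη / s) e q2 (s ^ 2) C0 C x =
      replaced131 (s ^ P.d * wη) (cη / s) e q2 (s ^ 2) aK2 wη cη ek R0 C GK0 R1 GKk0 GK Gk0 GKk
        (fun _ => (1 : ℝ)) Hk0 Hk x := by
  rw [replaced131, eq131 _ _ _ _ _ aK2 h125₀ h125 h127₀ h127 x, basicCTLoc_one, hGk0, hGk,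
    basicCT_rescale_balaban wη cη e ek q2 s hs Hk0 Hk hek x]

end Literature.MathematicalPhysics.QuantumFieldTheory.Balaban1983to89.B3Eq131Example
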